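import Summits.QuantumFields.YangMills.Theorems.InfiniteVolumeContinuumTemperedCalibrationKLocalCeilings
import Summits.QuantumFields.YangMills.Theorems.InfiniteVolumeContinuumTemperedCalibrationKFine
import Summits.QuantumFields.YangMills.Theorems.InfiniteVolumeContinuumTemperedCurrenciesDefs
import Summits.QuantumFields.YangMills.Theorems.AtomicCalibrationRMirrorCalibrationK
import Summits.QuantumFields.YangMills.Theorems.SquareRootCeilingsMirrorDomination

/-!
# Leaf `HypercubicOSDataFromInfiniteVolume` (stmt-QuantumFields-19868), LINES «TemperedPeak» / «OctaveDoubling» — the registered stub CAL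
# `stub_temperedCalibrationK : OnsetFloorsK → PinnedTemperedCeiling → TemperedAtomCeilingsK` BY NAME — part 3/3: assembly

The B6K calibration (`AtomicCalibrationR.MirrorCalibration.mirrorCalibrationK_proof`, planner ym-idea-11 g15/g17) re-run with the TEMPERED on-axis
mirror ceiling E_T (`PinnedTemperedCeiling`) in place of `SubOnsetTwoPointCeilings`, and with the scale-local E1 (part 1) in place of the landed E1:

1. datum, level `ε := min ε₁ ε₀`, joint onset unit `a` (`jointOnsetUnit`: floors AT `a β` = the PIN of E_T, and the sub-onset guard above `2aβ`);
2. the tempered torus ceiling at the unit for GENERAL `(2R+4)`-separated pairs — E_T at axis `0` fed to the landed RP mirror domination with an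
   abstract bound (`MirrorDomination.abs_cov_le_of_axisMirror`, bound `(C/R⁴)²·(ℓ₄/(R aβ))^M`) — and its inheritance by the odd-torus limit states
   (`twoPoint_limitState`);
3. the admissible profile `b` and its constants; the two atom-scale regimes: COARSE `s > δ/8` (✓`rpSquare_le_coarse`, `≤ E`) and FINE
   `K aβ < s ≤ δ/8` (part 2 `rpSquare_le_fine_tempered`, `≤ E·(s/aβ)^M`) — TEMPERED DOMINATION `rpSquare ≤ E (s/aβ)^M` for every sub-cell-offset atom
   of scale `s > K aβ`, in place of B6's onset domination;
4. the scale-local E1 (`TemperedCalibration.atomCeiling_local`, contraction from the landed `OnsetContraction`) at level `η := E (s/aβ)^M`;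
5. the dilated unit `K·a` (floors by `lowerBoundsK_const_mul_iff`), `ε_TAC := E·K^M`: `E (s/aβ)^M = E K^M (s/(K aβ))^M`.

HONEST LABEL: calibration / bookkeeping on HYPOTHESES (E_T = item-26791-class wall currency, `OnsetFloorsK` = the N-wall residual); closes the registered stub
CAL of two DRAFT lines (PWP light) on the R2a-IV leaf; their load-bearing D1/D2 and N, E3T, K2R stay OPEN; no crux, rung, leaf or summit; nothing
about Bałaban's RG or Clay is asserted; the Yang–Mills mass gap is NOT proved. [folklore]
-/

set_option autoImplicit false

noncomputable section

open scoped BigOperators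
open MeasureTheory Filter Topology
open Literature.MathematicalPhysics.QuantumFieldTheory Literature.MathematicalPhysics.QuantumLattice
open Literature.Probability.LatticeModels (Site)
open Summit.QuantumFields.YangMills.Theorems.InfiniteVolume (stateMomentStr)
open Summit.QuantumFields.YangMills.Cruxes.OSLegsFromFemtoAndGap.DlrCollarTransfer
open Summit.QuantumFields.YangMills.Cruxes.AtomicCalibrationR.MirrorCalibration
open Summit.QuantumFields.YangMills.Cruxes.HypercubicOSDataFromInfiniteVolume.TemperedCalibration (atomCeiling_local rpSquare_le_fine_tempered)

namespace Summit.QuantumFields.YangMills.Cruxes.HypercubicOSDataFromInfiniteVolume.TemperedCurrencies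

/-- **CAL `stub_temperedCalibrationK`** — the registered stub of the g19 lines «TemperedPeak» / «OctaveDoubling» on stmt-QuantumFields-19868, by name and
signature: the compact-witness onset floors and the pinned tempered on-axis mirror ceiling give the calibrated unit together with tempered atom
ceilings in ceiling form at the atom's own scale. [folklore] -/
theorem stub_temperedCalibrationK : OnsetFloorsK → PinnedTemperedCeiling → TemperedAtomCeilingsK := by
  intro hF hT G _ _ _ _ hG hcl
  letI : MeasurableSpace G := borel G
  haveI : BorelSpace G := ⟨rfl⟩
  -- §1 datum (compact witnesses), level, unit
  obtain ⟨r, v, f, g, h, ε₁, Λ₅, β₅, hvK, hfK, hgK, hhK, hv, hfg, hgh, hfh, hε₁, hfloor⟩ := hF G hG hcl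
  obtain ⟨ε₀, hε₀, hT'⟩ := hT G hG hcl r v f g h Λ₅
  have hεpos : 0 < min ε₁ ε₀ := lt_min hε₁ hε₀
  have hfloorε : ∀ β : ℝ, β₅ ≤ β → ∃ s : ℝ, 0 < s ∧ s ≤ 1 ∧
      (∀ L : ℕ, Λ₅ ≤ s * L → min ε₁ ε₀ ≤ Q2 G r β L s (thetaTest 4 v) v) ∧
      (∀ L : ℕ, Λ₅ ≤ s * L → min ε₁ ε₀ ≤ |Q3 G r β L s f g h|) := by
    intro β hβ
    obtain ⟨s, hs0, hs1, h2, h3⟩ := hfloor β hβ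
    exact ⟨s, hs0, hs1, fun L hL => (min_le_left _ _).trans (h2 L hL), fun L hL => (min_le_left _ _).trans (h3 L hL)⟩
  have hvan := fun (s₀ : ℝ) (hs₀ : 0 < s₀) =>
    Summit.QuantumFields.YangMills.Theorems.OnsetCalibration.onsetVanishes_proof G hG hcl r v f g h (min ε₁ ε₀) Λ₅ s₀
      hεpos hs₀
  obtain ⟨a, ha_pos, ha_le, ha0, -, hcal⟩ :=
    jointOnsetUnit r v f g h (min ε₁ ε₀) Λ₅ β₅ hεpos hv hfg hgh hfh hfloorε hvan
  obtain ⟨M, C, ℓ₄, β₄, hℓ₄, hC, hceil⟩ := hT' (min ε₁ ε₀) hεpos (min_le_right _ _)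
    ⟨β₅, fun β hβ => ⟨a β, ha_pos β, ha_le β, (hcal β hβ).1.1, (hcal β hβ).1.2⟩⟩
  -- §1K the compact-witness floors AT THE UNIT, for the same witnesses
  have hlbK : LowerBoundsK G r a :=
    ⟨⟨v, min ε₁ ε₀, β₅, Λ₅, hvK, hv, hεpos, fun β hβ L hL => (hcal β hβ).1.1 L hL⟩,
      ⟨f, g, h, min ε₁ ε₀, β₅, Λ₅, hfK, hgK, hhK, hfg, hgh, hfh, hεpos, fun β hβ L hL => (hcal β hβ).1.2 L hL⟩⟩
  -- §2 the TEMPERED torus two-point ceiling AT THE UNIT for general separated pairs: E_T on the axis, then RP mirror domination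
  have hceilU : ∀ β : ℝ, max (max β₄ β₅) 0 ≤ β → ∀ (R : ℕ), 1 ≤ R → (R : ℝ) * a β ≤ ℓ₄ →
      ∀ (L : ℕ) (q q' : Fin 4 × Fin 4) (x y : Fin 4 → ℤ), q.1 < q.2 → q'.1 < q'.2 → 4 * R + 8 ≤ L →
      (∃ k : Fin 4, (2 * (R : ℤ) + 4) ≤ |((((x k - y k : ℤ) : ZMod (2 * L + 1))).valMinAbs : ℤ)|) →
      |torusE G r β L (fun U => (plane G r q x U - torusE G r β L (plane G r q x)) *
        (plane G r q' y U - torusE G r β L (plane G r q' y)))| ≤ (C / (R : ℝ) ^ 4) ^ 2 * (ℓ₄ / ((R : ℝ) * a β)) ^ M := by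
    intro β hβ R hR hRa L q q' x y hq hq' hL hsep
    have hβ4 : β₄ ≤ β := le_trans (le_max_left _ _) (le_trans (le_max_left _ _) hβ)
    have hβ5 : β₅ ≤ β := le_trans (le_max_right _ _) (le_trans (le_max_left _ _) hβ)
    have hβ0 : (0 : ℝ) ≤ β := le_trans (le_max_right _ _) hβ
    obtain ⟨k, hk⟩ := hsep
    refine Summit.QuantumFields.YangMills.Theorems.MirrorDomination.abs_cov_le_of_axisMirror G r hβ0 hR hL
      (fun q₁ t hq₁ ht htL => ?_) hq hq' x y k hk
    refine hceil β hβ4 (a β) (ha_pos β) (ha_le β) (fun s' h2s hs1 hfl => ?_) (hcal β hβ5).1 L q₁ 0 R t hq₁ hR hRa hL ht htL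
    have := (hcal β hβ5).2 s' (by linarith [ha_pos β]) hs1 hfl.1 hfl.2
    linarith
  -- §3 inheritance by the limit states
  have hceilμ : ∀ β : ℝ, max (max β₄ β₅) 0 ≤ β → ∀ μ ∈ oddTorusLimitPoints r β, ∀ (R : ℕ), 1 ≤ R →
      (R : ℝ) * a β ≤ ℓ₄ → ∀ (q q' : Fin 4 × Fin 4) (x y : Fin 4 → ℤ), q.1 < q.2 → q'.1 < q'.2 →
      (∃ k : Fin 4, (2 * (R : ℤ) + 4) ≤ |x k - y k|) →
      |stateMomentStr G r μ 2 ![q, q'] ![x, y]| ≤ (C / (R : ℝ) ^ 4) ^ 2 * (ℓ₄ / ((R : ℝ) * a β)) ^ M :=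
    fun β hβ μ hμ R hR hRa q q' x y hq hq' hsep =>
      twoPoint_limitState r (hceilU β hβ R hR hRa) hμ q q' x y hq hq' hsep
  -- §4 the admissible profile and its constants `t` (support radius), `δ` (time floor), `Mb` (sup), `Cp`
  obtain ⟨b, hbc, hbsupp, hbint, hperm, htime⟩ :=
    Summit.QuantumFields.YangMills.Theorems.OnsetTautology.admissibleAtomProfile_proof
  obtain ⟨t, ht0, hbt'⟩ := hbc.isCompact.isBounded.subset_closedBall_lt 0 (0 : EuclideanSpace ℝ (Fin 4))
  have hbt : Function.support (b : EuclideanSpace ℝ (Fin 4) → ℝ) ⊆ Metric.closedBall 0 t :=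
    (subset_tsupport _).trans hbt'
  have hne : (tsupport (b : EuclideanSpace ℝ (Fin 4) → ℝ)).Nonempty := by
    by_contra hemp
    rw [Set.not_nonempty_iff_eq_empty, tsupport_eq_empty_iff] at hemp
    exact hbint (by simp [hemp])
  have hcont : Continuous fun u : EuclideanSpace ℝ (Fin 4) => u 0 :=
    PiLp.continuous_apply (p := 2) (β := fun _ : Fin 4 => ℝ) 0
  obtain ⟨u₀, hu₀mem, hu₀min⟩ := hbc.isCompact.exists_isMinOn hne hcont.continuousOn
  obtain ⟨δ, hδpos, hδ⟩ : ∃ δ : ℝ, 0 < δ ∧ ∀ u, b u ≠ 0 → δ ≤ u 0 :=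
    ⟨u₀ 0, hbsupp hu₀mem, fun u hu => (isMinOn_iff.1 hu₀min) u (subset_tsupport _ (Function.mem_support.2 hu))⟩
  obtain ⟨Mb, hMb⟩ : ∃ Mb : ℝ, ∀ u, |b u| ≤ Mb := ⟨SchwartzMap.seminorm ℝ 0 0 b, fun u => by
    have := SchwartzMap.norm_le_seminorm ℝ b u
    rwa [Real.norm_eq_abs] at this⟩
  obtain ⟨Cp, hCp⟩ := exists_abs_plane_le (G := G) r
  obtain ⟨T, hT₀⟩ := htime
  -- §5 the constants of the domination: dilation `K ≥ max 1 (δ/ℓ₄)`, level `E` above both regime bounds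
  obtain ⟨K, hK1, hKδ⟩ : ∃ K : ℝ, 1 ≤ K ∧ δ / ℓ₄ ≤ K := ⟨max 1 (δ / ℓ₄), le_max_left _ _, le_max_right _ _⟩
  have hKpos : 0 < K := lt_of_lt_of_le one_pos hK1
  obtain ⟨E, hEpos, hEc, hEf⟩ : ∃ E : ℝ, 0 < E ∧
      ((2 * ((⌈8 * t / δ⌉₊ + 3 : ℕ) : ℝ) + 1) ^ 4) ^ 2 * Mb ^ 2 * (2 * Cp) ^ 2 < E ∧
      Mb ^ 2 * (C ^ 2 * (4 * (t + δ) / δ) ^ 8) * (2 * ℓ₄ / δ) ^ M < E := by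
    have h1 : 0 ≤ ((2 * ((⌈8 * t / δ⌉₊ + 3 : ℕ) : ℝ) + 1) ^ 4) ^ 2 * Mb ^ 2 * (2 * Cp) ^ 2 := by positivity
    have h2 : 0 ≤ Mb ^ 2 * (C ^ 2 * (4 * (t + δ) / δ) ^ 8) * (2 * ℓ₄ / δ) ^ M := by positivity
    refine ⟨((2 * ((⌈8 * t / δ⌉₊ + 3 : ℕ) : ℝ) + 1) ^ 4) ^ 2 * Mb ^ 2 * (2 * Cp) ^ 2 +
      Mb ^ 2 * (C ^ 2 * (4 * (t + δ) / δ) ^ 8) * (2 * ℓ₄ / δ) ^ M + 1, ?_, ?_, ?_⟩ <;> linarith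
  -- §6 TEMPERED DOMINATION above the dilated unit `K · a β`: every sub-cell-offset atom of scale `s` has `rpSquare ≤ E (s/aβ)^M`
  have hdom : ∀ β : ℝ, max (max β₄ β₅) 0 ≤ β → ∀ μ ∈ oddTorusLimitPoints r β, ∀ s : ℝ, K * a β < s →
      ∀ (q : Fin 4 × Fin 4) (y : EuclideanSpace ℝ (Fin 4)), (∀ i, 0 ≤ y i ∧ y i ≤ s) →
        rpSquare r μ b {q} s y ≤ E * (s / a β) ^ M := by
    intro β hβ μ hμ s hlt q y hy
    have haβ := ha_pos β
    have hs0 : 0 < s := lt_trans (mul_pos hKpos haβ) hlt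
    have hsa : 1 ≤ s / a β := by
      rw [le_div_iff₀ haβ]; nlinarith
    have hpow : 1 ≤ (s / a β) ^ M := one_le_pow₀ hsa
    haveI : IsProbabilityMeasure μ := by
      have hμ' := hμ
      obtain ⟨S₀, -, hp, -⟩ := hμ'
      exact hp
    by_cases hreg : δ / 8 < s
    · have := rpSquare_le_coarse r μ hbt ht0 hδpos hMb hCp hs0 hreg hy q
      have hE1 : E ≤ E * (s / a β) ^ M := le_mul_of_one_le_right hEpos.le hpow
      linarith only [this, hEc, hE1]
    · have := rpSquare_le_fine_tempered r μ hbt ht0 hδpos hδ hMb haβ hℓ₄ hKpos hKδ (hceilμ β hβ μ hμ) hs0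
        (not_lt.1 hreg) hlt hy q
      have hsp : 0 ≤ (s / a β) ^ M := by positivity
      have hE2 : Mb ^ 2 * (C ^ 2 * (4 * (t + δ) / δ) ^ 8) * ((2 * ℓ₄ / δ) ^ M * (s / a β) ^ M) ≤ E * (s / a β) ^ M := by
        rw [← mul_assoc]
        exact mul_le_mul_of_nonneg_right hEf.le hsp
      exact this.trans hE2
  -- §7 the dilated unit `a' := K · a`, level `E · K^M`, and the scale-local E1 at level `E (s/aβ)^M`
  have hev : ∀ᶠ β in atTop, a β ≤ 1 / K := ha0.eventually (eventually_le_nhds (by positivity))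
  obtain ⟨β₀, hβ₀⟩ := Filter.eventually_atTop.1 hev
  refine ⟨r, fun β => K * a β, b, E * K ^ M, M, ⟨hbc, hbsupp, hbint, hperm, ⟨T, hT₀⟩⟩, by positivity,
    fun β => mul_pos hKpos (ha_pos β), ?_, ?_, ⟨max (max (max β₄ β₅) 0) β₀, fun β hβ => ⟨?_, ?_⟩⟩⟩
  · simpa using ha0.const_mul K
  · exact (lowerBoundsK_const_mul_iff r a hKpos).2 hlbK
  · have := hβ₀ β (le_trans (le_max_right _ _) hβ)
    rw [le_div_iff₀ hKpos] at this
    linarith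
  · intro μ hμ S q s t' y k c hq hs hKs ht' hS hside
    have hβ' : max (max β₄ β₅) 0 ≤ β := le_trans (le_max_left _ _) hβ
    have hβ0 : (0 : ℝ) ≤ β := le_trans (le_max_right _ _) hβ'
    haveI : SecondCountableTopology G := r.secondCountableTopology
    haveI : T2Space G := r.t2Space
    have hcon : Contracts r μ b := fun Q s' y' m hs' hy' =>
      Summit.QuantumFields.YangMills.Theorems.OnsetTautologyOnsetContraction.onsetContraction_proof G hG hcl r β μ b Q s' y'
        m hβ0 hμ hbc hbsupp hs' hy'
    have haβ := ha_pos β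
    -- the level at scale `s`: `E K^M (s/(K aβ))^M = E (s/aβ)^M`
    have hlev : E * K ^ M * (s / (K * a β)) ^ M = E * (s / a β) ^ M := by
      rw [mul_assoc, ← mul_pow]
      congr 2
      field_simp
    rw [hlev]
    have hη : 0 ≤ E * (s / a β) ^ M := by positivity
    exact atomCeiling_local r hμ b hcon hT₀ hperm (E * (s / a β) ^ M) hη S q s t' y k c hq hs
      (fun q₁ y₁ hy₁ => hdom β hβ' μ hμ s hKs q₁ y₁ hy₁) ht' hS hside

end Summit.QuantumFields.YangMills.Cruxes.HypercubicOSDataFromInfiniteVolume.TemperedCurrencies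

end
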